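import Literature.NumberTheory.DiophantineGeometry.AbcWave0GranvilleStarkHeights
import Literature.NumberTheory.DiophantineGeometry.AbcWave0GranvilleStarkModulus
import Literature.NumberTheory.EllipticCurves.SingularModuliGaloisStable
import HarnessLib

/-!
# Granville–Stark, Theorem 1: uniform `abc` ⟹ `h(−d) ≥ (π/3 + o(1)) √d / log d`, from its CM inputs

Topic `NumberTheory/DiophantineGeometry` (family `abc`, record `abc.S22`).  Third of three
proofs-only files (theorems only: no definitions, no named facts; see
`AbcWave0GranvilleStarkHeights.lean`, `AbcWave0GranvilleStarkModulus.lean`) on the named fact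
`Literature.NumberTheory.DiophantineGeometry.granville_stark : UniformABCConjecture → ImaginaryQuadraticClassNumberBound`
(A. Granville, H. M. Stark, *ABC implies no "Siegel zeros" for `L`-functions of characters with
negative discriminant*, Invent. Math. 139 (2000), Theorem 1, in the weaker "`∑ 1/a ≥ 1`" form
vendored in `AbcWave0.lean`).

## What is proved

`granville_stark_of_cmInput` : **the whole deduction of Theorem 1 (§2 of the paper, p. 5), sorry-free,
from the two classical facts about singular moduli that it quotes**, supplied as ONE explicit
hypothesis `H` in existential form — for every imaginary quadratic field `K`, `D = d_K`, there are a
number field `F ⊂ ℂ` (embedding `ι`) and algebraic integers `g₂, g₃ ∈ 𝓞_F` with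

* `ι(g₂³) = j(τ_D)` and `ι(g₃²) = j(τ_D) − 1728`, where `j(τ_D) = formJ (principalForm D)` is the
  singular modulus of the principal class (`τ_D = (−1+√D)/2` or `√D/2`; Granville–Stark p. 4:
  "The value of `j(τ)` at `τ = (−1+√−d)/2` or `√−d/2` … is an algebraic integer", with (5)
  `j(τ) = γ₂(τ)³ = γ₃(τ)² + 1728`, so that `γ₂(τ), γ₃(τ)` are algebraic integers — Weber [15];
  Cox, *Primes of the form x² + ny²*, Thm. 11.1: "`j(𝔞)` is an algebraic integer"), and
* `|D_F| ≤ (6√|D|)^{[F:ℚ]}`, i.e. root discriminant `Δ_F ≤ 6√|D|` (Granville–Stark **Lemma 1**: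
  "If `K = k(γ₂(τ), γ₃(τ))` … then `Δ_K ≤ 6√d`", `k = ℚ(√−d)`; proved there from Shimura
  reciprocity — `γ₂, γ₃` lie in the ray class field of `k` mod `6` — and the
  conductor–discriminant formula; Táfula, Lemma 5.4).

`H` is implied by (integrality of `j(τ_D)`) ∧ (Lemma 1) with `F = ℚ(√D, γ₂(τ_D), γ₃(τ_D))`,
`g₂ = γ₂(τ_D)`, `g₃ = γ₃(τ_D)`; neither is in the tree or in Mathlib (no integrality of singular
moduli — the tree has their algebraicity and conjugates, Cox Thm. 10.23, `isIntegral_formJ`,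
`natDegree_minpoly_formJ_le_classNumber`, which ARE used here — no Weber functions, no class field
theory), so they are kept as the hypothesis of this reduction rather than minted as named facts
(D-0026); `granville_stark_holds` is exactly `granville_stark_of_cmInput` applied to a proof of `H`.

## The proof (Granville–Stark p. 5 with explicit constants; Táfula Lemma 5.5)

Given `δ > 0` put `ε = min(1/10, δ/13)`, get `C = C(ε)` from `UniformABCConjecture`, and let `K`
be imaginary quadratic with `d = |d_K| ≥ max(d₀, 16)`.  With `F, ι, g₂, g₃` from `H`, apply abc in
`F` (degree `n`) to `a + b = c`, `a = g₃²`, `b = 1728`, `c = g₂³` (nonzero since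
`|j(τ_D)| ≥ e^{π√d} − 784 > 1729`, `exp_sub_le_norm_formJ_principalForm`):
`H_F(a:b:c) < Cⁿ (|D_F| N_F)^{1+ε}`.  Lower bound: `M := ∏_σ max(1,|σc|) ≤ 1728ⁿ H_F`
(`prod_max_le_mulHeight_triple`) and `log M ≥ (n/h_K)(π√d − log 2)` (`div_mul_log_le_log_prod_max`
with `deg c = deg j(τ_D) ≤ h(d_K) ≤ h_K`, `card_reducedForms_discr_le_classNumber`, and
`|j(τ_D)| ≥ e^{π√d}/2`) — this is (7).  Upper bound: the bad primes divide `6 g₂ g₃`, so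
`N_F ≤ |N(6 g₂ g₃)| = 6ⁿ N₂ N₃` with `N₂³ = ∏|σ g₂|³ ≤ M`, `N₃² ≤ 1729ⁿ M`
(`radicalNorm_le_absNorm_span`; "`N_K(γ₂³, γ₃², 1728) ≪ N(γ₂,1)N(γ₃,1) ≤ … ≪ H^{5/6}`"), and
`|D_F| ≤ (6√d)ⁿ`.  Taking logarithms, `((1−5ε)/6) log M < n(A₀ + ((1+ε)/2) log d)`, whence
`π√d − log 2 < h_K (κ log d + A₁)` with `κ = 3(1+ε)/(1−5ε)`, `κ(π/3 − δ) < π`, and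
`granvilleStark_asymptotics` gives `(π/3 − δ)√d/log d ≤ h_K`.

## References

* A. Granville, H. M. Stark, *ABC implies no "Siegel zeros" for `L`-functions of characters with
  negative discriminant*, Invent. Math. 139 (2000) 509–523: §1 eq. (1) and Theorem 1 (p. 2),
  §2 (p. 4: `τ`, integrality, Lemma 1), proof of Theorem 1 with (5′), (6), (7) (p. 5)
  (held copy `paper:galaxy-pdf-4469120640`). [GranvilleStark2000]
* C. Táfula, *On Landau–Siegel zeros and heights of singular moduli*, Acta Arith. 201 (2021)
  1–28 (arXiv:1911.07215): §2.2 (CM facts), Lemma 5.4 (= Lemma 1), Lemma 5.5. [Tafula2021]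
* D. A. Cox, *Primes of the form x² + ny²*, 2nd ed., Wiley 2013, Thm. 7.7(ii), Thm. 10.23,
  Thm. 11.1. [Cox2013]
-/

noncomputable section

open Complex NumberField Height
open scoped Real

open Literature.NumberTheory.EllipticCurves Literature.NumberTheory.QuadraticFields.BinaryQuadraticForm
  Literature.NumberTheory.QuadraticFields.Quadratic

namespace Literature.NumberTheory.DiophantineGeometry

/-- **Granville–Stark, Theorem 1 (uniform `abc` ⟹ `h(−d) ≥ (π/3 + o(1))√d/log d`), deduced from
its CM inputs.**  Hypothesis `H` (see the module docstring): for every imaginary quadratic field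
`K`, `D = d_K`, there are a number field `F` with an embedding `ι : F → ℂ` and `g₂, g₃ ∈ 𝓞_F` with
`ι(g₂³) = j(τ_D)`, `ι(g₃²) = j(τ_D) − 1728` (`j(τ_D)`, hence `γ₂(τ_D) = ∛j`, `γ₃(τ_D) = √(j − 1728)`,
are algebraic integers: Granville–Stark §2 p. 4 / Cox Thm. 11.1) and `|D_F| ≤ (6√|D|)^{[F:ℚ]}`
(Granville–Stark, Lemma 1: `Δ_{k(γ₂(τ),γ₃(τ))} ≤ 6√d`).  Conclusion: the named fact
`granville_stark`, i.e. `UniformABCConjecture → ImaginaryQuadraticClassNumberBound`.  The proof is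
Granville–Stark's (§2, proof of Theorem 1: abc for `γ₃² + 1728 = γ₂³` in `F`, the conductor bound
`N ≪ H^{5/6}`, (6), and the lower bound (7) for the principal class) with explicit constants.
[cite: GranvilleStark2000, Theorem 1 and §2 (Lemma 1, proof of Theorem 1)] -/
theorem granville_stark_of_cmInput
    (H : ∀ (K : Type) [Field K] [NumberField K], IsImaginaryQuadratic K →
      ∃ (F : Type) (_ : Field F) (_ : NumberField F) (ι : F →+* ℂ) (g₂ g₃ : 𝓞 F),
        ι ((g₂ : F) ^ 3) = formJ (principalForm (NumberField.discr K)) ∧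
        ι ((g₃ : F) ^ 2) = formJ (principalForm (NumberField.discr K)) - 1728 ∧
        |(NumberField.discr F : ℝ)| ≤ (6 * √|(NumberField.discr K : ℝ)|) ^ Module.finrank ℚ F) :
    granville_stark := by
  intro habc δ hδ
  /- constants -/
  set ε : ℝ := min (1 / 10) (δ / 13) with hε
  have hε0 : 0 < ε := lt_min (by norm_num) (by linarith)
  have hε10 : ε ≤ 1 / 10 := min_le_left _ _
  have hε13 : ε ≤ δ / 13 := min_le_right _ _
  obtain ⟨C, hC⟩ := habc ε hε0
  set C' : ℝ := max |C| 1 with hC'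
  have hC'1 : 1 ≤ C' := le_max_right _ _
  have hCC' : ∀ m : ℕ, C ^ m ≤ C' ^ m := fun m =>
    (le_abs_self _).trans ((abs_pow C m).symm ▸ pow_le_pow_left₀ (abs_nonneg C) (le_max_left _ _) m)
  set s : ℝ := 1 + ε with hs
  set θ₆ : ℝ := (1 - 5 * ε) / 6 with hθ₆
  have hθ₆0 : 0 < θ₆ := by rw [hθ₆]; linarith
  set A₀ : ℝ := Real.log 1728 + Real.log C' + s * Real.log 36 + s / 2 * Real.log 1729 with hA₀
  set κ : ℝ := s / (2 * θ₆) with hκ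
  set A₁ : ℝ := A₀ / θ₆ with hA₁
  have hκ0 : 0 < κ := by rw [hκ]; positivity
  have hmargin : κ * (π / 3 - δ) < π := by
    rw [hκ, div_mul_eq_mul_div, div_lt_iff₀ (by positivity)]
    rw [hs, hθ₆]
    nlinarith [Real.pi_gt_three, Real.pi_lt_d2, hε13, hε10, hε0, hδ]
  clear_value ε C' s θ₆ A₀ κ A₁
  obtain ⟨d₁, hd₁0, hd₁⟩ :=
    granvilleStark_asymptotics (A := A₁) (L := Real.log 2) (δ := δ) hκ0 hmargin
  refine ⟨max d₁ 16, ?_⟩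
  intro K _ _ h2 hreal hd
  have hK : IsImaginaryQuadratic K :=
    ⟨h2, (NumberField.nrRealPlaces_eq_zero_iff (K := K)).mp hreal⟩
  /- the CM input and an integral basis, then abbreviate the discriminant -/
  obtain ⟨F, instF, instNF, ι, g₂, g₃, hg₂, hg₃, hdiscF⟩ := H K hK
  obtain ⟨bK, hbK⟩ := exists_basis_zero_eq_one (K := K) hK.1
  have hDK := discr_eq_sq_add_four_mul bK hbK
  set D : ℤ := NumberField.discr K with hDdef
  have hDneg : D < 0 := hK.discr_neg
  have habsD : |(D : ℝ)| = -(D : ℝ) := abs_of_neg (by exact_mod_cast hDneg)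
  rw [habsD] at hd hdiscF ⊢
  have hd16 : (16 : ℝ) ≤ -(D : ℝ) := (le_max_right _ _).trans hd
  have hdd₁ : d₁ ≤ -(D : ℝ) := (le_max_left _ _).trans hd
  have hD16 : D ≤ -16 := by
    have : ((16 : ℤ) : ℝ) ≤ ((-D : ℤ) : ℝ) := by push_cast; exact hd16
    have := Int.cast_le.mp this
    omega
  have h4 : D % 4 = 0 ∨ D % 4 = 1 := by
    have e : D = discr (1, bK.repr (bK 1 * bK 1) 1, -(bK.repr (bK 1 * bK 1) 0)) := by
      rw [discr_apply, hDK]; ring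
    rw [e]; exact discr_emod_four _
  /- the singular modulus of the principal class -/
  set P := principalForm D with hP
  have hP1 : 0 < P.1 := by rw [hP, principalForm_fst]; exact one_pos
  have hPprim : IsPrimitive P := isPrimitive_principalForm D
  have hPdisc : discr P = D := discr_principalForm h4
  set j₀ : ℂ := formJ P with hj₀
  obtain ⟨hjlow, hX⟩ := exp_sub_le_norm_formJ_principalForm hD16 h4
  set X := Real.exp (π * √(-(D : ℝ))) with hXdef
  have hj1729 : 1729 < ‖j₀‖ := by linarith
  have hjhalf : X / 2 ≤ ‖j₀‖ := by linarith
  have hlogj : π * √(-(D : ℝ)) - Real.log 2 ≤ Real.log ‖j₀‖ := by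
    have e : Real.log (X / 2) = π * √(-(D : ℝ)) - Real.log 2 := by
      rw [Real.log_div (Real.exp_pos _).ne' two_ne_zero, Real.log_exp]
    rw [← e]
    exact Real.log_le_log (by positivity) hjhalf
  have hmaxj : max 1 ‖j₀‖ = ‖j₀‖ := max_eq_right (by linarith)
  /- degree of `j₀` at most `h(D) ≤ h_K` -/
  have hdegj : (minpoly ℚ j₀).natDegree ≤ NumberField.classNumber K := by
    have h1 := natDegree_minpoly_formJ_le_classNumber hP1 hPprim (by rw [hPdisc]; exact hDneg)
    rw [hPdisc] at h1
    have h2 : Literature.NumberTheory.QuadraticFields.BinaryQuadraticForm.classNumber D ≤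
        NumberField.classNumber K := card_reducedForms_discr_le_classNumber hK
    exact h1.trans h2
  /- the abc triple `g₃² + 1728 = g₂³` in `F` -/
  set n : ℕ := Module.finrank ℚ F with hn
  have hnpos : 0 < n := Module.finrank_pos
  set c : F := (g₂ : F) ^ 3 with hc
  set a : F := (g₃ : F) ^ 2 with ha
  have hιc : ι c = j₀ := hg₂
  have hιa : ι a = j₀ - 1728 := hg₃
  have hc0 : c ≠ 0 := by
    intro h
    rw [h, map_zero] at hιc
    rw [← hιc, norm_zero] at hj1729
    linarith
  have ha0 : a ≠ 0 := by
    intro h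
    rw [h, map_zero] at hιa
    have : j₀ = 1728 := by linear_combination -hιa
    rw [this] at hj1729
    norm_num at hj1729
  have hb0 : (1728 : F) ≠ 0 := by norm_num
  have habc_eq : a + 1728 = c := ι.injective (by rw [map_add, map_ofNat, hιa, hιc]; ring)
  have hg₂0 : g₂ ≠ 0 := fun h => hc0 (by rw [hc, h]; simp)
  have hg₃0 : g₃ ≠ 0 := fun h => ha0 (by rw [ha, h]; simp)
  have hdegc : (minpoly ℚ c).natDegree ≤ NumberField.classNumber K := by
    have e : minpoly ℚ (ι.toRatAlgHom c) = minpoly ℚ c := minpoly.algHom_eq _ ι.injective c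
    rw [← e]
    show (minpoly ℚ (ι c)).natDegree ≤ _
    rw [hιc]
    exact hdegj
  have habc' := hC F a (1728 : F) c ha0 hb0 hc0 habc_eq
  rw [← hn] at habc'
  /- `M = ∏_σ max(1, |σ c|)` and its lower bound -/
  set M : ℝ := ∏ φ : F →+* ℂ, max 1 ‖φ c‖ with hM
  have hM1 : 1 ≤ M := by
    rw [hM]
    calc (1 : ℝ) = ∏ _φ : F →+* ℂ, (1 : ℝ) := Finset.prod_const_one.symm
      _ ≤ _ := Finset.prod_le_prod (fun _ _ => zero_le_one) fun φ _ => le_max_left _ _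
  have hMpos : 0 < M := by linarith
  have hlow : (n : ℝ) / NumberField.classNumber K * Real.log ‖j₀‖ ≤ Real.log M := by
    have := div_mul_log_le_log_prod_max ι c hdegc
    rwa [hιc, hmaxj] at this
  have hMH : M ≤ 1728 ^ n * mulHeight ![a, (1728 : F), c] := prod_max_le_mulHeight_triple g₂ g₃
  /- the conductor: bad primes divide `6 g₂ g₃` -/
  set s₀ : 𝓞 F := 6 * g₂ * g₃ with hs₀
  have hs₀0 : s₀ ≠ 0 := mul_ne_zero (mul_ne_zero (by norm_num) hg₂0) hg₃0
  have hbad : badPrimes (((g₃ ^ 2 : 𝓞 F)) : F) (((1728 : 𝓞 F)) : F) (((g₂ ^ 3 : 𝓞 F)) : F) ⊆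
      {v | s₀ ∈ v.asIdeal} := by
    refine badPrimes_subset_of_forall fun v hv => ?_
    have hPr := v.isPrime
    have h6 : (6 : 𝓞 F) ∉ v.asIdeal := fun h => hv (by
      have := v.asIdeal.mul_mem_right (g₂ * g₃) h
      rwa [← mul_assoc] at this)
    have hg₂v : g₂ ∉ v.asIdeal := fun h => hv (by
      have := v.asIdeal.mul_mem_left (6 * g₃) h
      rwa [show 6 * g₃ * g₂ = s₀ by rw [hs₀]; ring] at this)
    have hg₃v : g₃ ∉ v.asIdeal := fun h => hv (v.asIdeal.mul_mem_left (6 * g₂) h)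
    refine ⟨fun h => hg₃v (hPr.mem_of_pow_mem 2 h), fun h => ?_, fun h => hg₂v (hPr.mem_of_pow_mem 3 h)⟩
    have e : (1728 : 𝓞 F) = 6 ^ 3 * 2 ^ 3 := by norm_num
    rw [e] at h
    rcases hPr.mem_or_mem h with h' | h'
    · exact h6 (hPr.mem_of_pow_mem 3 h')
    · have h2 : (2 : 𝓞 F) ∈ v.asIdeal := hPr.mem_of_pow_mem 3 h'
      have := v.asIdeal.mul_mem_right (3 : 𝓞 F) h2
      exact h6 (by rwa [show (2 : 𝓞 F) * 3 = 6 by norm_num] at this)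
  set N₂ : ℝ := ∏ φ : F →+* ℂ, ‖φ (g₂ : F)‖ with hN₂
  set N₃ : ℝ := ∏ φ : F →+* ℂ, ‖φ (g₃ : F)‖ with hN₃
  have hN₂pos : 0 < N₂ := Finset.prod_pos fun φ _ => norm_pos_iff.mpr (by
    rw [map_ne_zero_iff _ φ.injective]; exact_mod_cast hg₂0)
  have hN₃pos : 0 < N₃ := Finset.prod_pos fun φ _ => norm_pos_iff.mpr (by
    rw [map_ne_zero_iff _ φ.injective]; exact_mod_cast hg₃0)
  have hcardemb : (Finset.univ : Finset (F →+* ℂ)).card = n := by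
    rw [Finset.card_univ, NumberField.Embeddings.card]
  have hrad : (radicalNorm a (1728 : F) c : ℝ) ≤ 6 ^ n * N₂ * N₃ := by
    have h0 := radicalNorm_le_absNorm_span hs₀0 hbad
    have e1 : (((g₃ ^ 2 : 𝓞 F)) : F) = a := by rw [ha]; push_cast; rfl
    have e2 : (((1728 : 𝓞 F)) : F) = 1728 := by rw [RingOfIntegers.coe_eq_algebraMap, map_ofNat]
    have e3 : (((g₂ ^ 3 : 𝓞 F)) : F) = c := by rw [hc]; push_cast; rfl
    rw [e1, e2, e3] at h0
    have h0' : (radicalNorm a (1728 : F) c : ℝ) ≤ (Ideal.absNorm (Ideal.span {s₀}) : ℝ) := by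
      exact_mod_cast h0
    rw [absNorm_span_singleton_eq_prod_embeddings] at h0'
    have hprodS : ∏ φ : F →+* ℂ, ‖φ (s₀ : F)‖ = 6 ^ n * N₂ * N₃ := by
      have hφ : ∀ φ : F →+* ℂ, ‖φ (s₀ : F)‖ = 6 * (‖φ (g₂ : F)‖ * ‖φ (g₃ : F)‖) := by
        intro φ
        have es : ((s₀ : 𝓞 F) : F) = 6 * (g₂ : F) * (g₃ : F) := by
          rw [hs₀]; push_cast; rfl
        rw [es, map_mul, map_mul, map_ofNat, norm_mul, norm_mul]
        norm_num
        ring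
      simp_rw [hφ, Finset.prod_mul_distrib, Finset.prod_const, hcardemb]
      rw [← hN₂, ← hN₃]
      ring
    rw [hprodS] at h0'
    exact h0'
  /- `N₂³ ≤ M` and `N₃² ≤ 1729ⁿ M` -/
  have hN₂M : N₂ ^ 3 ≤ M := by
    rw [hN₂, hM, ← Finset.prod_pow]
    refine Finset.prod_le_prod (fun _ _ => by positivity) fun φ _ => ?_
    rw [← norm_pow, ← map_pow]
    exact le_max_right _ _
  have hN₃M : N₃ ^ 2 ≤ 1729 ^ n * M := by
    rw [hN₃, hM, ← Finset.prod_pow, ← hcardemb, ← Finset.prod_const, ← Finset.prod_mul_distrib]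
    refine Finset.prod_le_prod (fun _ _ => by positivity) fun φ _ => ?_
    rw [← norm_pow, ← map_pow, show (g₃ : F) ^ 2 = c - 1728 by rw [← habc_eq, ha]; ring, map_sub,
      map_ofNat]
    calc ‖φ c - 1728‖ ≤ ‖φ c‖ + ‖(1728 : ℂ)‖ := norm_sub_le _ _
      _ = ‖φ c‖ + 1728 := by norm_num
      _ ≤ 1729 * max 1 ‖φ c‖ := by
          have h1 : (1 : ℝ) ≤ max 1 ‖φ c‖ := le_max_left _ _
          have h2 : ‖φ c‖ ≤ max 1 ‖φ c‖ := le_max_right _ _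
          linarith
  clear_value M N₂ N₃
  /- the abc inequality, upper bound -/
  have hdpos : 0 < -(D : ℝ) := by linarith
  have hsqpos : 0 < √(-(D : ℝ)) := Real.sqrt_pos.mpr hdpos
  set Y : ℝ := (6 * √(-(D : ℝ))) ^ n * (6 ^ n * N₂ * N₃) with hY
  have hYpos : 0 < Y :=
    mul_pos (pow_pos (mul_pos (by norm_num) hsqpos) n) (mul_pos (mul_pos (pow_pos (by norm_num) n) hN₂pos) hN₃pos)
  clear_value Y
  have hΔR : |(NumberField.discr F : ℝ)| * (radicalNorm a (1728 : F) c : ℝ) ≤ Y := by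
    rw [hY]
    exact mul_le_mul hdiscF hrad (by positivity) (by positivity)
  have hupper : mulHeight ![a, (1728 : F), c] < C' ^ n * Y ^ s := by
    refine habc'.trans_le ?_
    have h1 : (|(NumberField.discr F : ℝ)| * (radicalNorm a (1728 : F) c : ℝ)) ^ s ≤ Y ^ s :=
      Real.rpow_le_rpow (by positivity) hΔR (by rw [hs]; linarith)
    calc C ^ n * (|(NumberField.discr F : ℝ)| * (radicalNorm a (1728 : F) c : ℝ)) ^ s
        ≤ C' ^ n * (|(NumberField.discr F : ℝ)| * (radicalNorm a (1728 : F) c : ℝ)) ^ s :=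
          mul_le_mul_of_nonneg_right (hCC' n) (by positivity)
      _ ≤ C' ^ n * Y ^ s := mul_le_mul_of_nonneg_left h1 (by positivity)
  have hMT : M < 1728 ^ n * C' ^ n * Y ^ s := by
    calc M ≤ 1728 ^ n * mulHeight ![a, (1728 : F), c] := hMH
      _ < 1728 ^ n * (C' ^ n * Y ^ s) := by gcongr
      _ = _ := by ring
  /- logarithms -/
  have hC'pos : 0 < C' := by linarith
  have hlogM : Real.log M < n * Real.log 1728 + n * Real.log C' + s * Real.log Y := by
    have := Real.log_lt_log hMpos hMT
    rwa [Real.log_mul (mul_pos (pow_pos (by norm_num) n) (pow_pos hC'pos n)).ne' (Real.rpow_pos_of_pos hYpos s).ne',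
      Real.log_mul (pow_pos (by norm_num) n).ne' (pow_pos hC'pos n).ne',
      Real.log_pow, Real.log_pow, Real.log_rpow hYpos] at this
  have hlogY : Real.log Y = n * (Real.log 36 + Real.log (-(D : ℝ)) / 2) + Real.log N₂ + Real.log N₃ := by
    have h6s : 0 < 6 * √(-(D : ℝ)) := mul_pos (by norm_num) hsqpos
    rw [hY, Real.log_mul (pow_pos h6s n).ne' (mul_pos (mul_pos (pow_pos (by norm_num) n) hN₂pos) hN₃pos).ne',
      Real.log_mul (mul_pos (pow_pos (by norm_num) n) hN₂pos).ne' hN₃pos.ne',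
      Real.log_mul (pow_pos (by norm_num) n).ne' hN₂pos.ne', Real.log_pow, Real.log_pow,
      Real.log_mul (by norm_num) hsqpos.ne', Real.log_sqrt hdpos.le,
      show Real.log 36 = Real.log 6 + Real.log 6 by rw [← Real.log_mul (by norm_num) (by norm_num)]; norm_num]
    ring
  -- names for the logarithms (products stay in a fixed syntactic shape for `linarith`)
  have hlogN₂' : ((3 : ℕ) : ℝ) * Real.log N₂ ≤ Real.log M := by
    have := Real.log_le_log (pow_pos hN₂pos 3) hN₂M
    rwa [Real.log_pow] at this
  have hlogN₃' : ((2 : ℕ) : ℝ) * Real.log N₃ ≤ (n : ℝ) * Real.log 1729 + Real.log M := by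
    have := Real.log_le_log (pow_pos hN₃pos 2) hN₃M
    rwa [Real.log_mul (pow_pos (by norm_num) n).ne' hMpos.ne', Real.log_pow, Real.log_pow] at this
  set lM := Real.log M with hlM
  set l₂ := Real.log N₂ with hl₂
  set l₃ := Real.log N₃ with hl₃
  set ld := Real.log (-(D : ℝ)) with hld
  set lY := Real.log Y with hlY
  clear_value lM l₂ l₃ lY
  have hlogN₂ : 3 * l₂ ≤ lM := by push_cast at hlogN₂'; linarith
  have hlogN₃ : 2 * l₃ ≤ n * Real.log 1729 + lM := by push_cast at hlogN₃'; linarith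
  have hs0 : 0 < s := by rw [hs]; linarith
  -- `θ₆ log M < n (A₀ + (s/2) log d)`
  have hY' : lY ≤ n * Real.log 36 + n * ld / 2 + (5 / 6) * lM + n * Real.log 1729 / 2 := by
    rw [hlogY]; linarith
  have hsY : s * lY ≤ s * (n * Real.log 36) + s * (n * ld / 2) + s * ((5 / 6) * lM) +
      s * (n * Real.log 1729 / 2) := by
    calc s * lY ≤ s * (n * Real.log 36 + n * ld / 2 + (5 / 6) * lM + n * Real.log 1729 / 2) :=
          mul_le_mul_of_nonneg_left hY' hs0.le
      _ = _ := by ring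
  have e1 : θ₆ * lM = lM - s * ((5 / 6) * lM) := by rw [hθ₆, hs]; ring
  have e2 : (n : ℝ) * (A₀ + s / 2 * ld) = n * Real.log 1728 + n * Real.log C' + s * (n * Real.log 36) +
      s * (n * Real.log 1729 / 2) + s * (n * ld / 2) := by rw [hA₀]; ring
  have hmain1 : θ₆ * lM < n * (A₀ + s / 2 * ld) := by
    rw [e1, e2]; linarith
  /- lower bound and conclusion -/
  set hK' : ℝ := (NumberField.classNumber K : ℝ) with hhK'
  have hhpos : 0 < hK' := by rw [hhK']; exact_mod_cast NumberField.classNumber_pos (K := K)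
  set Y' : ℝ := π * √(-(D : ℝ)) - Real.log 2 with hY'def
  have hnR : (0 : ℝ) < n := by exact_mod_cast hnpos
  have hq : 0 < θ₆ * ((n : ℝ) / hK') := mul_pos hθ₆0 (div_pos hnR hhpos)
  have hmain2 : θ₆ * ((n : ℝ) / hK' * Y') < n * (A₀ + s / 2 * ld) := by
    have h1 : (n : ℝ) / hK' * Y' ≤ lM := (mul_le_mul_of_nonneg_left hlogj (div_pos hnR hhpos).le).trans hlow
    have h2 : θ₆ * ((n : ℝ) / hK' * Y') ≤ θ₆ * lM := mul_le_mul_of_nonneg_left h1 hθ₆0.le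
    linarith
  have hmain3 : Y' ≤ hK' * (κ * ld + A₁) := by
    have h' : Y' < n * (A₀ + s / 2 * ld) / (θ₆ * ((n : ℝ) / hK')) := by
      rw [lt_div_iff₀ hq]
      have : Y' * (θ₆ * ((n : ℝ) / hK')) = θ₆ * ((n : ℝ) / hK' * Y') := by ring
      linarith
    have e : n * (A₀ + s / 2 * ld) / (θ₆ * ((n : ℝ) / hK')) = hK' * (κ * ld + A₁) := by
      rw [hκ, hA₁]
      field_simp
      ring
    exact (h'.trans_eq e).le
  obtain ⟨-, -, hfin⟩ := hd₁ (-(D : ℝ)) hdd₁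
  exact hfin hK' hhpos hmain3

end Literature.NumberTheory.DiophantineGeometry

end
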